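import Summits.ResolutionOfSingularities.ResolutionOfSingularities.Theorems.WildConesClassicalRegimesStubMuDropCharTwoOrdPDict
import Summits.ResolutionOfSingularities.ResolutionOfSingularities.Theorems.FrobeniusClosingCampaignW41FormalTorsorLemmas
import Literature.AlgebraicGeometry.Resolution.MvPowerSeriesChainRule
import Literature.AlgebraicGeometry.Resolution.PowerSeriesCleaning
import HarnessLib

/-!
# Crux `Steer` (stmt-ResolutionOfSingularities-16345), line `switching_dichotomy` r9, stub `stub_core4Dictionary`:
# the TYPED RUN read off a chain of formal charts (chain W4.1, lead res-L0-w41-lead-1) — part 1 of the leaf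

OURS (campaign res-hironaka, rung L, slot W4.1; replaces the role of no printed item; NOT a statement of the
manuscript under review; AI-written, weaker than expert review). The formal half of the valuation-run dictionary
behind the registered stub `stub_core4Dictionary` (skeleton r9, sha 24abaaa5): if along a chain of subrings
`S m ≤ S (m+1)` of `K` we are given ring homomorphisms `φ m : S m →+* κ⟦X_1..X_d⟧` (`κ` perfect of characteristic
`p`) whose transitions are the typed blow-up-and-translate substitutions `Φ_{j,τ}`
(`X_j ↦ X_j`, `X_s ↦ X_j (X_s + τ_s)`, the family of `Theorems.WildCones.MuDropCharTwoOrdP.blowFam`), radicands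
`f (m+1) · x_m^p = f m - g_m^p` with `φ (m+1) x_m = X_j · unit`, the blow-up order lemma
(`X_j^e ∣ Φ(H) ⇒ e ≤ ord H`, hypothesis `hS`) and `(X)^N ⊆ (∂ φ_m f_m)` at every stage, then the coefficient
function of `φ 0 f_0` starts an `InfRun` of the typed point-blow-up dynamics (`infRun_of_charts`). Key identity
(`ser_step_eq`): `ser (run m) = qClean (F_m · U_m^p)` with `U_m` a unit, propagated by
`MuDropCharTwoOrdP.X_pow_mul_serT_eq_subst` (`X_j^p · T = Φ(ser c)`), `X_j ∣ Q ⇐ X_j^p ∣ Q^p`, and «cleaning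
kills `p`-th powers»; `Isol ∧ MultP` at a stage from `(X)^N ≤ (∂F)` and `F ≡ G^p (mod 𝔪^p)`
(`isol_multP_of_state`, using res-L0-w41-stub-1's `FormalTorsorLemmas`, p473056). Part 2
(`FrobeniusClosingSteerCore4DictionaryLeaf.lean`) builds the charts along the quadratic sequence of a
zero-dimensional valuation and concludes. [cite: arXiv:1802.05010, §§2–3] [cite: Matsumura1987, Thm. 29.7]
-/

noncomputable section

-- single-problem summit: the doubled namespace component `ResolutionOfSingularities` is forced by the tree layout
set_option linter.dupNamespace false

open Classical
open Literature.AlgebraicGeometry.Resolution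
open MvPowerSeries IsLocalRing
open Summit.ResolutionOfSingularities.ResolutionOfSingularities.Theorems.WildCones

namespace Summit.ResolutionOfSingularities.ResolutionOfSingularities.Theorems.SwitchingDichotomy.Core4Dictionary

variable {K : Type} [Field K]

/-! ## Formal states: a series read as a coefficient function -/

section Formal

variable {κ : Type} [Field κ] {d : ℕ} (p : ℕ)

/-- Cleaning the coefficient function of a series `F` (a typed state). [folklore] -/
theorem clean_cF (F : MvPowerSeries (Fin d) κ) (A : Fin d →₀ ℕ) :
    clean p d κ (fun A : Fin d → ℕ => coeff (Finsupp.equivFunOnFinite.symm A) F) ⇑A =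
      if (∀ j, p ∣ A j) then 0 else coeff A F := by
  unfold clean
  simp only [Finsupp.equivFunOnFinite_symm_coe]

/-- The cleaned series of the state read off `F` is the `p`-cleaning of `F`. [folklore] -/
theorem ser_cF (F : MvPowerSeries (Fin d) κ) :
    ser p d κ (fun A : Fin d → ℕ => coeff (Finsupp.equivFunOnFinite.symm A) F) = qClean p F := by
  ext A
  rw [MuDropCharTwoOrdP.coeff_ser, clean_cF]
  by_cases h : ∀ j, p ∣ A j
  · rw [if_pos h, coeff_qClean_of_dvd p F h]
  · rw [if_neg h, coeff_qClean_of_not_dvd p F h]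

/-- `step` only sees the cleaning of a state. -/
theorem step_congr {c c' : (Fin d → ℕ) → κ} (h : clean p d κ c = clean p d κ c') (i : Fin d)
    (τ : Fin d → κ) : step p d κ i τ c = step p d κ i τ c' := by
  unfold step
  rw [h]

/-- Two states with the same cleaned series have the same cleaning. -/
theorem clean_eq_of_ser_eq {c c' : (Fin d → ℕ) → κ} (h : ser p d κ c = ser p d κ c') :
    clean p d κ c = clean p d κ c' := by
  funext A
  have := congrArg (fun F => coeff (Finsupp.equivFunOnFinite.symm A) F) h
  simpa [MuDropCharTwoOrdP.coeff_ser] using this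

end Formal

/-! ## Power-series lemmas for the typed induction -/

section SeriesLemmas

variable {κ : Type} [Field κ] {d : ℕ} (p : ℕ) [CharP κ p]

/-- Coefficients of a `p`-th power on the `p`-divisible lattice: `coeff (p • B) (Q ^ p) = (coeff B Q) ^ p`. -/
theorem coeff_smul_pow_char [Fact p.Prime] (Q : MvPowerSeries (Fin d) κ) (B : Fin d →₀ ℕ) :
    coeff (p • B) (Q ^ p) = coeff B Q ^ p := by
  haveI : ExpChar κ p := ExpChar.prime Fact.out
  have h := MvPowerSeries.map_frobenius_expand (p := p) (hp := (Fact.out : p.Prime).ne_zero) (f := Q)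
  rw [← h, MvPowerSeries.coeff_map, MvPowerSeries.coeff_expand_smul, frobenius_def]

/-- `X_j ^ p ∣ Q ^ p ⇒ X_j ∣ Q` in `κ⟦X⟧` (characteristic `p`). -/
theorem X_dvd_of_X_pow_dvd_pow [Fact p.Prime] (j : Fin d) (Q : MvPowerSeries (Fin d) κ)
    (h : X j ^ p ∣ Q ^ p) :
    X j ∣ Q := by
  rw [MvPowerSeries.X_dvd_iff]
  intro B hB
  have hX : X j ∣ Q ^ p := (dvd_pow_self (X j) (Fact.out : p.Prime).ne_zero).trans h
  rw [MvPowerSeries.X_dvd_iff] at hX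
  have h1 : coeff (p • B) (Q ^ p) = 0 := hX (p • B) (by simp [hB])
  rw [coeff_smul_pow_char p Q B] at h1
  exact pow_eq_zero_iff (Fact.out : p.Prime).ne_zero |>.mp h1

/-- Cleaning kills `p`-th powers. -/
theorem qClean_pow [Fact p.Prime] (B : MvPowerSeries (Fin d) κ) : qClean p (B ^ p) = 0 := by
  ext A
  by_cases h : ∀ l, p ∣ A l
  · rw [coeff_qClean_of_dvd p _ h, map_zero]
  · rw [coeff_qClean_of_not_dvd p _ h, map_zero]
    push Not at h
    exact TorsorDict.coeff_pow_char_eq_zero p B h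

/-- Cleaning is blind to `p`-th-power corrections. -/
theorem qClean_add_pow [Fact p.Prime] (A B : MvPowerSeries (Fin d) κ) :
    qClean p (A + B ^ p) = qClean p A := by
  rw [qClean_add, qClean_pow p B, add_zero]

/-- Over a perfect field the deleted part of a series is a `p`-th power: `G = qClean G + P ^ p`. -/
theorem exists_eq_qClean_add_pow [Fact p.Prime] [PerfectField κ] (G : MvPowerSeries (Fin d) κ) :
    ∃ P : MvPowerSeries (Fin d) κ, G = qClean p G + P ^ p := by
  have h : ∀ e : Fin d →₀ ℕ, (∃ j, ¬ p ∣ e j) → coeff e (G - qClean p G) = 0 := by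
    intro e he
    have hne : ¬ ∀ l, p ∣ e l := fun hall => by obtain ⟨j, hj⟩ := he; exact hj (hall j)
    rw [map_sub, coeff_qClean_of_not_dvd p G hne, sub_self]
  obtain ⟨P, hP⟩ := (TorsorDict.exists_pow_eq_iff p (G - qClean p G)).mpr h
  exact ⟨P, by rw [hP]; ring⟩

/-- Formal partials of `F · U ^ p` (characteristic `p`). -/
theorem pderiv_mul_pow_char (l : Fin d) (F U : MvPowerSeries (Fin d) κ) :
    MvPowerSeries.pderiv l (F * U ^ p) = U ^ p * MvPowerSeries.pderiv l F := by
  haveI := TorsorDict.charP_mvPowerSeries (σ := Fin d) (κ := κ) p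
  have hUp : MvPowerSeries.pderiv l (U ^ p) = 0 :=
    (MvPowerSeries.pderiv l).apply_pow_char_eq_zero p U
  rw [Derivation.leibniz, hUp, smul_zero, zero_add, smul_eq_mul]

/-- The ideal of partials of `F · U ^ p`, `U` a unit, is that of `F`. -/
theorem span_pderiv_mul_unit_pow (F U : MvPowerSeries (Fin d) κ) (hU : IsUnit U) :
    Ideal.span (Set.range fun l : Fin d => MvPowerSeries.pderiv l (F * U ^ p)) =
      Ideal.span (Set.range fun l : Fin d => MvPowerSeries.pderiv l F) := by
  apply le_antisymm
  · rw [Ideal.span_le]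
    rintro _ ⟨l, rfl⟩
    show MvPowerSeries.pderiv l (F * U ^ p) ∈ _
    rw [pderiv_mul_pow_char p l F U]
    exact Ideal.mul_mem_left _ _ (Ideal.subset_span ⟨l, rfl⟩)
  · rw [Ideal.span_le]
    rintro _ ⟨l, rfl⟩
    show MvPowerSeries.pderiv l F ∈ _
    obtain ⟨u, hu⟩ := hU
    have : MvPowerSeries.pderiv l F = (↑(u⁻¹) : MvPowerSeries (Fin d) κ) ^ p *
        MvPowerSeries.pderiv l (F * U ^ p) := by
      rw [pderiv_mul_pow_char p l F U, ← mul_assoc, ← hu, ← mul_pow, Units.inv_mul, one_pow, one_mul]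
    rw [this]
    exact Ideal.mul_mem_left _ _ (Ideal.subset_span ⟨l, rfl⟩)

/-- Cleaning does not change the ideal of partials. -/
theorem span_pderiv_qClean (G : MvPowerSeries (Fin d) κ) :
    Ideal.span (Set.range fun l : Fin d => MvPowerSeries.pderiv l (qClean p G)) =
      Ideal.span (Set.range fun l : Fin d => MvPowerSeries.pderiv l G) := by
  have h : (fun l : Fin d => MvPowerSeries.pderiv l (qClean p G)) =
      fun l : Fin d => MvPowerSeries.pderiv l G := by
    funext l
    apply TorsorDict.pderiv_eq_of_coeff_eq p l
    intro e he
    have hne : ¬ ∀ l, p ∣ e l := fun hall => by obtain ⟨j, hj⟩ := he; exact hj (hall j)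
    exact coeff_qClean_of_not_dvd p G hne
  rw [h]

/-- `(X)^N ≤ I` makes `κ⟦X⟧ ⧸ I` finite over `κ`. -/
theorem finite_quotient_of_span_X_pow_le (I : Ideal (MvPowerSeries (Fin d) κ)) (N : ℕ)
    (h : Ideal.span (Set.range (X : Fin d → MvPowerSeries (Fin d) κ)) ^ N ≤ I) :
    Module.Finite κ (MvPowerSeries (Fin d) κ ⧸ I) := by
  rw [TorsorDict.finite_quotient_iff_exists_maximalIdeal_pow_le]
  exact ⟨N, by rwa [maximalIdeal_mvPowerSeries_eq_span]⟩

/-- If `(X)^N ≤ (∂_l G)_l` and `0 < d` then the cleaning of `G` is non-zero. -/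
theorem qClean_ne_zero_of_span_X_pow_le (hd : 0 < d) (G : MvPowerSeries (Fin d) κ) (N : ℕ)
    (h : Ideal.span (Set.range (X : Fin d → MvPowerSeries (Fin d) κ)) ^ N ≤
      Ideal.span (Set.range fun l : Fin d => MvPowerSeries.pderiv l G)) :
    qClean p G ≠ 0 := by
  intro h0
  have hspan : Ideal.span (Set.range fun l : Fin d => MvPowerSeries.pderiv l G) = ⊥ := by
    rw [← span_pderiv_qClean p G, h0]
    simp
  rw [hspan, le_bot_iff] at h
  have hX : (X (Fin.mk 0 hd) : MvPowerSeries (Fin d) κ) ^ N ∈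
      Ideal.span (Set.range (X : Fin d → MvPowerSeries (Fin d) κ)) ^ N :=
    Ideal.pow_mem_pow (Ideal.subset_span (Set.mem_range_self (Fin.mk 0 hd))) N
  rw [h, Ideal.mem_bot] at hX
  have hX0 : (X (Fin.mk 0 hd) : MvPowerSeries (Fin d) κ) = 0 := (pow_eq_zero_iff'.mp hX).1
  have := congrArg (coeff (Finsupp.single (Fin.mk 0 hd) 1)) hX0
  rw [MvPowerSeries.coeff_X, if_pos rfl, map_zero] at this
  exact one_ne_zero this

end SeriesLemmas

/-! ## The typed run read off a chain of charts -/

section TypedRun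

open Literature.RingTheory.MvPowerSeries.Jets

variable {κ : Type} [Field κ] {d : ℕ} (p : ℕ) [Fact p.Prime] [CharP κ p]

omit [Fact p.Prime] [CharP κ p] in
/-- The blow-up-and-translate substitution family `Φ_{j,τ}` (= `MuDropCharTwoOrdP.blowFam`) has no constant
terms. [folklore] -/
theorem constantCoeff_Φ (j : Fin d) (τ : Fin d → κ) (s : Fin d) :
    constantCoeff (if s = j then (X j : MvPowerSeries (Fin d) κ) else X j * (X s + C (τ s))) = 0 := by
  by_cases h : s = j
  · rw [if_pos h, constantCoeff_X]
  · rw [if_neg h, map_mul, constantCoeff_X, zero_mul]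

omit [Fact p.Prime] [CharP κ p] in
/-- Hence `Φ_{j,τ}` is substitutable. [folklore] -/
theorem hasSubst_Φ (j : Fin d) (τ : Fin d → κ) :
    HasSubst (fun s : Fin d => if s = j then (X j : MvPowerSeries (Fin d) κ) else X j * (X s + C (τ s))) :=
  hasSubst_of_constantCoeff_zero (constantCoeff_Φ j τ)

omit [Fact p.Prime] [CharP κ p] in
/-- `run (m+1) = step (j m) (τ m) (run m)` (definitional). -/
theorem run_succ (c₀ : (Fin d → ℕ) → κ) (j : ℕ → Fin d) (τ : ℕ → Fin d → κ) (m : ℕ) :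
    run p d κ c₀ j τ (m + 1) = step p d κ (j m) (τ m) (run p d κ c₀ j τ m) := rfl

omit [Fact p.Prime] [CharP κ p] in
/-- `clean c A` is the `A`-coefficient of `ser c`. -/
theorem clean_eq_coeff_ser (c : (Fin d → ℕ) → κ) (A : Fin d → ℕ) :
    clean p d κ c A = coeff (Finsupp.equivFunOnFinite.symm A) (ser p d κ c) := by
  rw [MuDropCharTwoOrdP.coeff_ser, Finsupp.coe_equivFunOnFinite_symm]

/-- One state of the typed run: from `ser c = qClean (F · U^p)`, `U` a unit, `(X)^N ≤ (∂F)` and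
`F ≡ G^p (mod 𝔪^p)` get `Isol c ∧ MultP c`. -/
theorem isol_multP_of_state (hd : 0 < d) (c : (Fin d → ℕ) → κ) (F G U : MvPowerSeries (Fin d) κ)
    (hU : IsUnit U) (hser : ser p d κ c = qClean p (F * U ^ p)) (N : ℕ)
    (hN : Ideal.span (Set.range (X : Fin d → MvPowerSeries (Fin d) κ)) ^ N ≤
      Ideal.span (Set.range fun l : Fin d => MvPowerSeries.pderiv l F))
    (hFG : F - G ^ p ∈ maximalIdeal (MvPowerSeries (Fin d) κ) ^ p) :
    Isol p d κ c ∧ MultP p d κ c := by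
  have hspan : Ideal.span (Set.range fun l : Fin d => MvPowerSeries.pderiv l (ser p d κ c)) =
      Ideal.span (Set.range fun l : Fin d => MvPowerSeries.pderiv l F) := by
    rw [hser, span_pderiv_qClean p, span_pderiv_mul_unit_pow p F U hU]
  have hN' : Ideal.span (Set.range (X : Fin d → MvPowerSeries (Fin d) κ)) ^ N ≤
      Ideal.span (Set.range fun l : Fin d => MvPowerSeries.pderiv l (F * U ^ p)) := by
    rwa [span_pderiv_mul_unit_pow p F U hU]
  have hFU : F * U ^ p - (G * U) ^ p ∈ maximalIdeal (MvPowerSeries (Fin d) κ) ^ p := by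
    have : F * U ^ p - (G * U) ^ p = (F - G ^ p) * U ^ p := by ring
    rw [this]
    exact Ideal.mul_mem_right _ _ hFG
  refine ⟨?_, ?_, ?_⟩
  · rw [MuDropCharTwoOrdP.isol_iff_finite_pderiv, hspan]
    exact finite_quotient_of_span_X_pow_le _ N hN
  · have hne : qClean p (F * U ^ p) ≠ 0 := qClean_ne_zero_of_span_X_pow_le p hd (F * U ^ p) N hN'
    obtain ⟨A, hA⟩ : ∃ A : Fin d →₀ ℕ, coeff A (qClean p (F * U ^ p)) ≠ 0 := by
      by_contra h
      push Not at h
      exact hne (MvPowerSeries.ext fun A => by rw [h A, map_zero])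
    refine ⟨⇑A, ?_⟩
    rw [clean_eq_coeff_ser, Finsupp.equivFunOnFinite_symm_coe, hser]
    exact hA
  · intro A hA
    set A' : Fin d →₀ ℕ := Finsupp.equivFunOnFinite.symm A with hA'
    rw [clean_eq_coeff_ser, hser] at hA
    have hndvd : ¬ ∀ l, p ∣ A' l := fun hall => hA (coeff_qClean_of_dvd p _ hall)
    rw [coeff_qClean_of_not_dvd p _ hndvd] at hA
    have hdeg : ¬ A'.degree < p := fun hlt =>
      hA (TorsorDict.coeff_eq_zero_of_sub_pow_mem p hFU (by push Not at hndvd; exact hndvd) hlt)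
    rw [MuDropCharTwoOrdP.degree_eq_sum_univ] at hdeg
    have hAA : ∀ j, A' j = A j := fun j => by rw [hA']; rfl
    simp only [hAA] at hdeg
    omega

variable [PerfectField κ]

/-- **One step of the typed run.** If `ser c = qClean (F · U^p)` (`U` a unit), `c` has multiplicity `p`, and
the next radicand satisfies `F' · (X_j w)^p = Φ_{j,τ}(F - G^p)` (`w` a unit), then
`ser (step j τ c) = qClean (F' · U'^p)` for a unit `U'`. -/
theorem ser_step_eq (c : (Fin d → ℕ) → κ) (jm : Fin d) (τm : Fin d → κ)
    (F F' G U w : MvPowerSeries (Fin d) κ) (hU : IsUnit U) (hw : IsUnit w)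
    (hser : ser p d κ c = qClean p (F * U ^ p)) (hM : MultP p d κ c)
    (hE : F' * (X jm * w) ^ p = subst (fun s : Fin d => if s = jm then (X jm : MvPowerSeries (Fin d) κ) else X jm * (X s + C (τm s))) (F - G ^ p)) :
    ∃ U' : MvPowerSeries (Fin d) κ, IsUnit U' ∧ ser p d κ (step p d κ jm τm c) = qClean p (F' * U' ^ p) := by
  haveI := TorsorDict.charP_mvPowerSeries (σ := Fin d) (κ := κ) p
  -- the successor series `T` before its final cleaning
  let T : MvPowerSeries (Fin d) κ :=
    show MvPowerSeries (Fin d) κ from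
      fun A : Fin d →₀ ℕ => tr d κ jm τm p (dv d κ jm p (bl d κ jm (clean p d κ c))) ⇑A
  have hX : X jm ^ p * T = subst (fun s : Fin d => if s = jm then (X jm : MvPowerSeries (Fin d) κ) else X jm * (X s + C (τm s))) (ser p d κ c) :=
    MuDropCharTwoOrdP.X_pow_mul_serT_eq_subst c jm τm hM
  have hstep : ser p d κ (step p d κ jm τm c) = qClean p T := by
    ext A
    rw [MuDropCharTwoOrdP.coeff_ser_step c jm τm hM A]
    by_cases h : ∀ l, p ∣ A l
    · rw [coeff_qClean_of_dvd p T h]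
      unfold clean
      rw [if_pos h]
    · rw [coeff_qClean_of_not_dvd p T h]
      unfold clean
      rw [if_neg h]
      rfl
  -- the substitution as a ring homomorphism
  let σ : MvPowerSeries (Fin d) κ →ₐ[κ] MvPowerSeries (Fin d) κ := substAlgHom (hasSubst_Φ (d := d) jm τm)
  have hσ : ∀ f, subst (fun s : Fin d => if s = jm then (X jm : MvPowerSeries (Fin d) κ) else X jm * (X s + C (τm s))) f = σ f := fun f => by rw [← coe_substAlgHom (hasSubst_Φ (d := d) jm τm)]
  rw [hσ] at hX hE
  -- `qClean (F U^p) = F U^p - P^p`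
  obtain ⟨P, hP⟩ := exists_eq_qClean_add_pow p (F * U ^ p)
  have hq : qClean p (F * U ^ p) = F * U ^ p - P ^ p := by rw [eq_sub_iff_add_eq, ← hP]
  -- the key identity `X^p · T = X^p · F' U'^p + Q^p`
  set U' : MvPowerSeries (Fin d) κ := w * σ U with hU'
  set Q : MvPowerSeries (Fin d) κ := σ G * σ U - σ P with hQ
  have hkey : X jm ^ p * T = X jm ^ p * (F' * U' ^ p) + Q ^ p := by
    have h1 : σ F = F' * (X jm * w) ^ p + σ G ^ p := by
      rw [map_sub, map_pow] at hE
      exact sub_eq_iff_eq_add.mp hE.symm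
    rw [hX, hser, hq, map_sub, map_mul, map_pow, map_pow, h1, hQ, hU', sub_pow_char]
    ring
  -- divisibility: `X ∣ Q`, then cancel `X^p`
  have hXne : (X jm : MvPowerSeries (Fin d) κ) ^ p ≠ 0 := by
    refine pow_ne_zero _ fun h => ?_
    have := congrArg (coeff (Finsupp.single jm 1)) h
    rw [MvPowerSeries.coeff_X, if_pos rfl, map_zero] at this
    exact one_ne_zero this
  have hdvd : X jm ^ p ∣ Q ^ p := ⟨T - F' * U' ^ p, by rw [mul_sub, hkey]; ring⟩
  obtain ⟨Q₁, hQ₁⟩ := X_dvd_of_X_pow_dvd_pow p jm Q hdvd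
  have hT : T = F' * U' ^ p + Q₁ ^ p := by
    have h2 : X jm ^ p * (T - F' * U' ^ p) = X jm ^ p * Q₁ ^ p := by
      rw [mul_sub, hkey, hQ₁]; ring
    have h3 := mul_left_cancel₀ hXne h2
    rw [← h3]; ring
  refine ⟨U', hw.mul (hU.map σ), ?_⟩
  rw [hstep, hT, qClean_add_pow]

/-- **The typed run of a chain of charts is an `InfRun`.** -/
theorem infRun_of_charts
    (hS : (∀ {κ : Type} [Field κ] {d : ℕ} (j : Fin d) (τ : Fin d → κ) (H : MvPowerSeries (Fin d) κ) (e : ℕ),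
      X j ^ e ∣ subst (fun s : Fin d => if s = j then (X j : MvPowerSeries (Fin d) κ) else X j * (X s + C (τ s))) H →
      (e : ℕ∞) ≤ H.order))
    (hd : 0 < d) (S : ℕ → Subring K) (hle : ∀ m, S m ≤ S (m + 1))
    (φ : ∀ m, S m →+* MvPowerSeries (Fin d) κ) (j : ℕ → Fin d) (τ : ℕ → Fin d → κ)
    (w : ℕ → MvPowerSeries (Fin d) κ) (hw : ∀ m, IsUnit (w m))
    (htrans : ∀ m (r : S m), φ (m + 1) (Subring.inclusion (hle m) r) = subst (fun s : Fin d => if s = (j m) then (X (j m) : MvPowerSeries (Fin d) κ) else X (j m) * (X s + C ((τ m) s))) (φ m r))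
    (f g x : ℕ → K) (hf : ∀ m, f m ∈ S m) (hg : ∀ m, g m ∈ S m) (hx : ∀ m, x m ∈ S m)
    (hφx : ∀ m, φ (m + 1) ⟨x m, hle m (hx m)⟩ = X (j m) * w m)
    (hrel : ∀ m, f (m + 1) * x m ^ p = f m - g m ^ p)
    (hisol : ∀ m, ∃ N : ℕ, Ideal.span (Set.range (X : Fin d → MvPowerSeries (Fin d) κ)) ^ N ≤
      Ideal.span (Set.range fun l : Fin d => MvPowerSeries.pderiv l (φ m ⟨f m, hf m⟩))) :
    InfRun p d κ (fun A : Fin d → ℕ => coeff (Finsupp.equivFunOnFinite.symm A) (φ 0 ⟨f 0, hf 0⟩)) j τ := by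
  -- the radicand relation read in the charts
  have hE : ∀ m, φ (m + 1) ⟨f (m + 1), hf (m + 1)⟩ * (X (j m) * w m) ^ p =
      subst (fun s : Fin d => if s = (j m) then (X (j m) : MvPowerSeries (Fin d) κ) else X (j m) * (X s + C ((τ m) s))) (φ m ⟨f m, hf m⟩ - φ m ⟨g m, hg m⟩ ^ p) := by
    intro m
    have h1 : (⟨f (m + 1), hf (m + 1)⟩ : S (m + 1)) * (⟨x m, hle m (hx m)⟩ : S (m + 1)) ^ p =
        Subring.inclusion (hle m) ⟨f m, hf m⟩ - (Subring.inclusion (hle m) ⟨g m, hg m⟩) ^ p :=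
      Subtype.ext (by simpa using hrel m)
    have h2 := congrArg (φ (m + 1)) h1
    rw [map_mul, map_pow, map_sub, map_pow, hφx, htrans, htrans] at h2
    rw [h2, ← coe_substAlgHom (hasSubst_Φ (j m) (τ m)), map_sub, map_pow]
  -- multiplicity `p` at every stage, from the next chart
  have hFG : ∀ m, φ m ⟨f m, hf m⟩ - φ m ⟨g m, hg m⟩ ^ p ∈ maximalIdeal (MvPowerSeries (Fin d) κ) ^ p := by
    intro m
    apply mem_maximalIdeal_pow_of_le_order
    apply hS (j m) (τ m)
    exact ⟨φ (m + 1) ⟨f (m + 1), hf (m + 1)⟩ * w m ^ p, by rw [← hE m]; ring⟩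
  -- the invariant
  have hQ : ∀ m, ∃ U : MvPowerSeries (Fin d) κ, IsUnit U ∧
      ser p d κ (run p d κ (fun A : Fin d → ℕ => coeff (Finsupp.equivFunOnFinite.symm A) (φ 0 ⟨f 0, hf 0⟩)) j τ m) =
        qClean p (φ m ⟨f m, hf m⟩ * U ^ p) := by
    intro m
    induction m with
    | zero => exact ⟨1, isUnit_one, by rw [one_pow, mul_one]; exact ser_cF p _⟩
    | succ m ih =>
      obtain ⟨U, hU, hser⟩ := ih
      obtain ⟨N, hN⟩ := hisol m
      have hM := (isol_multP_of_state p hd _ _ _ U hU hser N hN (hFG m)).2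
      rw [run_succ]
      exact ser_step_eq p _ (j m) (τ m) _ _ _ U (w m) hU (hw m) hser hM (hE m)
  intro m
  obtain ⟨U, hU, hser⟩ := hQ m
  obtain ⟨N, hN⟩ := hisol m
  exact isol_multP_of_state p hd _ _ _ U hU hser N hN (hFG m)

end TypedRun

end Summit.ResolutionOfSingularities.ResolutionOfSingularities.Theorems.SwitchingDichotomy.Core4Dictionary

end
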